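import Literature.NumberTheory.GelbartRogawski1991.LocalDoubledGaloisConjSiegelNonsplit
import Literature.NumberTheory.GelbartRogawski1991.LocalUnitaryUndoubling
import Literature.NumberTheory.Automorphic.UnitaryGroupLocalCongr
import HarnessLib

/-!
# Conjugation of the doubled group by a RATIONAL SIMILITUDE `k ⊕ k`: the Siegel parabolic `P_Δ` and `det_Δ` are preserved

Topic `NumberTheory/GelbartRogawski1991`; namespace `Literature.NumberTheory.GelbartRogawski1991.UnitaryDualPair.LocalSplitting` (home of ★ `IsSiegelDelta`,
`deltaBlock`, `detDelta`, `chiDet`, `inlLoc`).  KERNEL ONLY: theorems; no definition, no named fact, no `sorry`.  Cell `hodgecm-mathlib` (D-0151), programme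
P5 (crux HLiu418 = stmt-HodgeConjecture-24832), piece **P3a** of the road card `F0/P5/A-p18/g23/ROAD-L4if-v2.A-p18g23.md` §4 (A-p18 (g23), 2026-08-31): the
matrix layer of step (M3) «`θ_{λ,a}^{Ad k} ≅ θ_{λ,m₀a}`» for an `F`-RATIONAL SIMILITUDE `k₀ ∈ GL_n(F)` of the hermitian space `(Eⁿ, T₀ ⊗ 1)` with multiplier
`m₀` (`ᵗk₀ T₀ k₀ = m₀ T₀`; e.g. `k₀ = w T₀` in rank `2`, ★ `transpose_w_mul_form_mul_self`, multiplier `det T₀`).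

OBJECTS (no new definition): `KD := (reindexGL e₂ (blockDiagGL (k₀, k₀))) ⊗ 1 ∈ GL_{n+n}(E)` — the doubled similitude `k ⊕ k` of `(E^{n+n}, J^𝔻 = T^𝔻 ⊗ 1)`,
`T^𝔻 = T₀ ⊕ (−T₀)`; the automorphism `Ad(KD) : h ↦ KD h KD⁻¹` of `H(F_v) = U(J^𝔻)(F_v)` IS the tree's ★ `localCongr E c KD ha h v` (a rational similitude
`ᵗ(c KD) (a • J^𝔻) KD = J^𝔻`, `a = m₀⁻¹`, [PlatonovRapinchuk1994, §2.3]).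
* §1 `transpose_kd_mul_gramD_mul_kd` (`ᵗKD₀ T^𝔻 KD₀ = m₀ T^𝔻`), `formCongr_kd` / `formCongr_k` (the similitude identities feeding ★ `localCongr` at the doubled
  and undoubled level).
* §2 at every place `w ∣ v`: the `e₂`-blocks of `(KD h KD⁻¹)_w` are the `k_w`-conjugates of those of `h_w`, hence **`deltaBlock_localCongr_kd`**
  (`(KD h KD⁻¹)_Δ = k (h_Δ) k⁻¹`), **`detDelta_localCongr_kd`** (`det_Δ` is `Ad(KD)`-invariant), **`isSiegelDelta_localCongr_kd_iff`** (`P_Δ` is `Ad(KD)`-stable,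
  through ★ `isSiegelDelta_iff_blocks`), `chiDet_localCongr_kd` (`χ(det_Δ ·)` is `Ad(KD)`-invariant).
* §3 `localCongr_kd_inlLoc`: `Ad(KD)(g ⊕ 1) = Ad(k)(g) ⊕ 1` (compatibility with ★ `inlLoc`, for the undoubling step).
These are the hypotheses «`θ P_Δ ⊆ P_Δ`, `det_Δ ∘ θ = det_Δ`» of the tree's doubled rigidity transports (★ `DoubledWeilRepresentationIsometryTransport`, ★
`LocalLineIsometryRigidity`) for `θ = Ad(KD)`.  Nothing of the cited sources is asserted; HC_CM is proved only modulo the printed citations until rung 0 closes.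

## References
* [Kudla1994] S. Kudla, Israel J. Math. 87 (1994), §2 (the Siegel parabolic of the doubled space), §3 Thm. 3.1.
* [HarrisKudlaSweet1996] M. Harris, S. Kudla, W. Sweet, J. AMS 9 (1996), §1 (1.11), (1.15).
* [PlatonovRapinchuk1994] V. Platonov, A. Rapinchuk, Algebraic Groups and Number Theory (1994), §2.3.
* [MoeglinVignerasWaldspurger1987] LNM 1291 (1987), Chap. 1 I.17 (similitudes of hermitian spaces).
-/

set_option autoImplicit false
-- buildfix G11b-3 recipe (LEDGER B13-1/B13-3), as in the GelbartRogawski1991 siblings: elaborate sequentially.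
set_option Elab.async false

noncomputable section

open scoped Matrix
open NumberField IsDedekindDomain Matrix
open Literature.NumberTheory.Automorphic Literature.NumberTheory.Automorphic.UnitaryGroup

namespace Literature.NumberTheory.GelbartRogawski1991.UnitaryDualPair.LocalSplitting

/-! ## §0 Block algebra -/

section Blocks

variable {R : Type*} [CommRing R] {m : Type*} [Fintype m]

/-- coercion of `GeneralLinearGroup.map` (definitional). [folklore] -/
private theorem coe_glMap {S : Type*} [CommRing S] {l : Type*} [Fintype l] [DecidableEq l] (f : R →+* S) (g : GL l R) :
    ((Matrix.GeneralLinearGroup.map f g : GL l S) : Matrix l l S) = (g : Matrix l l R).map f := rfl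

/-- `(k ⊕ k) · (A B; C D) · (k′ ⊕ k′) = (kAk′ kBk′; kCk′ kDk′)`. [folklore] -/
private theorem fromBlocks_diag_mul_mul_fromBlocks_diag (k k' : Matrix m m R) (A B C D : Matrix m m R) :
    Matrix.fromBlocks k 0 0 k * Matrix.fromBlocks A B C D * Matrix.fromBlocks k' 0 0 k' =
      Matrix.fromBlocks (k * A * k') (k * B * k') (k * C * k') (k * D * k') := by
  rw [Matrix.fromBlocks_multiply, Matrix.fromBlocks_multiply]
  simp only [Matrix.zero_mul, Matrix.mul_zero, add_zero, zero_add]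

/-- the `e₂`-blocks of a conjugate by `k ⊕ k`: `(k ⊕ k) M (k′ ⊕ k′) = (k Mᵢⱼ k′)ᵢⱼ`. [folklore] -/
private theorem fromBlocks_diag_conj_eq (k k' : Matrix m m R) (M : Matrix (m ⊕ m) (m ⊕ m) R) :
    Matrix.fromBlocks k 0 0 k * M * Matrix.fromBlocks k' 0 0 k' =
      Matrix.fromBlocks (k * M.toBlocks₁₁ * k') (k * M.toBlocks₁₂ * k') (k * M.toBlocks₂₁ * k') (k * M.toBlocks₂₂ * k') := by
  conv_lhs => rw [← Matrix.fromBlocks_toBlocks M]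
  exact fromBlocks_diag_mul_mul_fromBlocks_diag k k' _ _ _ _

/-- `submatrix` along an equivalence is multiplicative (three factors). [folklore] -/
private theorem submatrix_mul_mul {l : Type*} [Fintype l] (e : l ≃ m) (A B C : Matrix m m R) :
    (A * B * C).submatrix e e = A.submatrix e e * B.submatrix e e * C.submatrix e e := by
  rw [Matrix.submatrix_mul_equiv, Matrix.submatrix_mul_equiv]

end Blocks

variable (F : Type) [Field F] [NumberField F] (E : Type) [Field E] [NumberField E] [Algebra F E]
  (c : E ≃ₐ[F] E) (v : HeightOneSpectrum (𝓞 F)) (n : ℕ) {T₀ : Matrix (Fin n) (Fin n) F}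
  {J : Matrix (Fin n) (Fin n) E} (hJ : J = T₀.map (algebraMap F E))
  {JD : Matrix (Fin (n + n)) (Fin (n + n)) E} (hJD : JD = (gramD F n T₀).map (algebraMap F E))
  (k₀ : GL (Fin n) F) (m₀ : F) (hk₀ : ((k₀ : Matrix (Fin n) (Fin n) F))ᵀ * T₀ * (k₀ : Matrix (Fin n) (Fin n) F) = m₀ • T₀)
  {k : GL (Fin n) E} (hk : k = Matrix.GeneralLinearGroup.map (algebraMap F E) k₀)
  {KD : GL (Fin (n + n)) E}
  (hKD : KD = Matrix.GeneralLinearGroup.map (algebraMap F E) (UnitaryGroup.reindexGL (e₂ n) (UnitaryGroup.blockDiagGL (k₀, k₀))))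

/-! ## §1 The doubled similitude `KD = k ⊕ k` -/

section Similitude

omit [NumberField F] in
include hk₀ in
/-- **`ᵗ(k₀ ⊕ k₀) · T^𝔻 · (k₀ ⊕ k₀) = m₀ T^𝔻`**: the doubled matrix of a similitude of `T₀` with multiplier `m₀` is a similitude of `T^𝔻 = T₀ ⊕ (−T₀)` with the
same multiplier. [cite: MoeglinVignerasWaldspurger1987, Chap. 1 I.17] [cite: HarrisKudlaSweet1996, §1 (1.9)] -/
theorem transpose_kd_mul_gramD_mul_kd :
    (((UnitaryGroup.reindexGL (e₂ n) (UnitaryGroup.blockDiagGL (k₀, k₀)) : GL (Fin (n + n)) F) : Matrix (Fin (n + n)) (Fin (n + n)) F))ᵀ *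
        gramD F n T₀ * ((UnitaryGroup.reindexGL (e₂ n) (UnitaryGroup.blockDiagGL (k₀, k₀)) : GL (Fin (n + n)) F) : Matrix _ _ F) =
      m₀ • gramD F n T₀ := by
  rw [UnitaryGroup.coe_reindexGL, UnitaryGroup.coe_blockDiagGL, gramD, Matrix.reindex_apply, Matrix.reindex_apply,
    Matrix.transpose_submatrix, Matrix.fromBlocks_transpose, ← submatrix_mul_mul, Matrix.fromBlocks_multiply, Matrix.fromBlocks_multiply]
  simp only [Matrix.transpose_zero, Matrix.zero_mul, Matrix.mul_zero, add_zero, zero_add, Matrix.mul_neg, Matrix.neg_mul, hk₀]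
  rw [show m₀ • (Matrix.fromBlocks T₀ 0 0 (-T₀)).submatrix (e₂ n).symm (e₂ n).symm =
      (m₀ • Matrix.fromBlocks T₀ 0 0 (-T₀)).submatrix (e₂ n).symm (e₂ n).symm from rfl, Matrix.fromBlocks_smul, smul_zero, smul_neg, neg_zero]

omit [NumberField F] [NumberField E] in
include hk₀ hKD hJD in
/-- **the doubled similitude identity for ★ `localCongr`**: `ᵗ(c KD) · (m₀⁻¹ • J^𝔻) · KD = J^𝔻` (`KD` is `F`-rational, so `c KD = KD`).
[cite: PlatonovRapinchuk1994, §2.3] [cite: MoeglinVignerasWaldspurger1987, Chap. 1 I.17] -/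
theorem formCongr_kd (hm₀ : m₀ ≠ 0) : formCongr (c : E →+* E) KD ((algebraMap F E m₀)⁻¹ • JD) = JD := by
  subst hKD hJD
  rw [formCongr, coe_glMap, RingHom.coe_coe, Matrix.map_map]
  have hc : ((c : E → E)) ∘ (algebraMap F E) = algebraMap F E := funext fun x => c.commutes x
  rw [hc, Matrix.mul_smul, Matrix.smul_mul, ← Matrix.transpose_map, ← Matrix.map_mul, ← Matrix.map_mul,
    transpose_kd_mul_gramD_mul_kd F n k₀ m₀ hk₀, Matrix.map_smul' _ _ _ (map_mul (algebraMap F E)), smul_smul,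
    inv_mul_cancel₀ ((map_ne_zero _).2 hm₀), one_smul]

omit [NumberField F] [NumberField E] in
include hk₀ hk hJ in
/-- the undoubled similitude identity for ★ `localCongr`: `ᵗ(c k) · (m₀⁻¹ • J) · k = J`. [cite: PlatonovRapinchuk1994, §2.3]
[cite: MoeglinVignerasWaldspurger1987, Chap. 1 I.17] -/
theorem formCongr_k (hm₀ : m₀ ≠ 0) : formCongr (c : E →+* E) k ((algebraMap F E m₀)⁻¹ • J) = J := by
  subst hk hJ
  rw [formCongr, coe_glMap, RingHom.coe_coe, Matrix.map_map]
  have hc : ((c : E → E)) ∘ (algebraMap F E) = algebraMap F E := funext fun x => c.commutes x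
  rw [hc, Matrix.mul_smul, Matrix.smul_mul, ← Matrix.transpose_map, ← Matrix.map_mul, ← Matrix.map_mul, hk₀,
    Matrix.map_smul' _ _ _ (map_mul (algebraMap F E)), smul_smul, inv_mul_cancel₀ ((map_ne_zero _).2 hm₀), one_smul]

end Similitude

/-! ## §2 `Ad(KD)` at a place `w ∣ v`: blocks, `det_Δ`, `P_Δ`, `χ(det_Δ)` -/

section Blocks

variable {a : E} (ha : a ≠ 0) (hKDJ : formCongr (c : E →+* E) KD (a • JD) = JD)

omit [NumberField F] in
include hk hKD in
/-- the matrix of `KD` at `w`: `reindex e₂ e₂ (k_w ⊕ k_w)`. [cite: PlatonovRapinchuk1994, §5.1] -/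
theorem coe_map_kd (w : PlacesOver E v) :
    ((Matrix.GeneralLinearGroup.map (algebraMap E (w.1.adicCompletion E)) KD : GL (Fin (n + n)) (w.1.adicCompletion E)) :
        Matrix (Fin (n + n)) (Fin (n + n)) (w.1.adicCompletion E)) =
      Matrix.reindex (e₂ n) (e₂ n) (Matrix.fromBlocks
        ((Matrix.GeneralLinearGroup.map (algebraMap E (w.1.adicCompletion E)) k : GL (Fin n) (w.1.adicCompletion E)) : Matrix _ _ _) 0 0
        ((Matrix.GeneralLinearGroup.map (algebraMap E (w.1.adicCompletion E)) k : GL (Fin n) (w.1.adicCompletion E)) : Matrix _ _ _)) := by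
  subst hk hKD
  rw [coe_glMap, coe_glMap, coe_glMap, coe_glMap, UnitaryGroup.coe_reindexGL, UnitaryGroup.coe_blockDiagGL, Matrix.map_map, Matrix.map_map,
    Matrix.reindex_apply, Matrix.reindex_apply, ← Matrix.submatrix_map, Matrix.fromBlocks_map,
    Matrix.map_zero _ (by rw [Function.comp_apply, map_zero, map_zero])]

omit [NumberField F] in
include hk hKD in
/-- the matrix of `KD⁻¹` at `w`: `reindex e₂ e₂ (k_w⁻¹ ⊕ k_w⁻¹)`. [cite: PlatonovRapinchuk1994, §5.1] -/
theorem coe_map_kd_inv (w : PlacesOver E v) :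
    (((Matrix.GeneralLinearGroup.map (algebraMap E (w.1.adicCompletion E)) KD)⁻¹ : GL (Fin (n + n)) (w.1.adicCompletion E)) :
        Matrix (Fin (n + n)) (Fin (n + n)) (w.1.adicCompletion E)) =
      Matrix.reindex (e₂ n) (e₂ n) (Matrix.fromBlocks
        (((Matrix.GeneralLinearGroup.map (algebraMap E (w.1.adicCompletion E)) k)⁻¹ : GL (Fin n) (w.1.adicCompletion E)) : Matrix _ _ _) 0 0
        (((Matrix.GeneralLinearGroup.map (algebraMap E (w.1.adicCompletion E)) k)⁻¹ : GL (Fin n) (w.1.adicCompletion E)) : Matrix _ _ _)) := by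
  subst hk hKD
  simp only [← map_inv, Prod.inv_mk]
  exact coe_map_kd F E v n k₀⁻¹ rfl rfl w

include hk hKD in
/-- **the `e₂`-blocks of `(KD h KD⁻¹)_w` are the `k_w`-conjugates of the `e₂`-blocks of `h_w`.** [cite: Kudla1994, §2] [cite: PlatonovRapinchuk1994, §2.3] -/
theorem reindex_coe_localCongr_kd (p : UnitaryGroup.localPi E c (n + n) JD v) (w : PlacesOver E v) :
    Matrix.reindex (e₂ n).symm (e₂ n).symm
        (((localCongr E c KD ha hKDJ v p : UnitaryGroup.localPi E c (n + n) JD v) : UnitaryGroup.LocalGLPi E (n + n) v) w :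
          Matrix (Fin (n + n)) (Fin (n + n)) (w.1.adicCompletion E)) =
      Matrix.fromBlocks ((Matrix.GeneralLinearGroup.map (algebraMap E (w.1.adicCompletion E)) k : GL (Fin n) (w.1.adicCompletion E)) : Matrix _ _ _)
          0 0 ((Matrix.GeneralLinearGroup.map (algebraMap E (w.1.adicCompletion E)) k : GL (Fin n) (w.1.adicCompletion E)) : Matrix _ _ _) *
        Matrix.reindex (e₂ n).symm (e₂ n).symm
          (((p : UnitaryGroup.LocalGLPi E (n + n) v) w : GL (Fin (n + n)) (w.1.adicCompletion E)) : Matrix _ _ (w.1.adicCompletion E)) *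
        Matrix.fromBlocks (((Matrix.GeneralLinearGroup.map (algebraMap E (w.1.adicCompletion E)) k)⁻¹ : GL (Fin n) (w.1.adicCompletion E)) : Matrix _ _ _)
          0 0 (((Matrix.GeneralLinearGroup.map (algebraMap E (w.1.adicCompletion E)) k)⁻¹ : GL (Fin n) (w.1.adicCompletion E)) : Matrix _ _ _) := by
  rw [coe_localCongr_apply_apply, Units.val_mul, Units.val_mul, coe_map_kd F E v n k₀ hk hKD w, coe_map_kd_inv F E v n k₀ hk hKD w]
  simp only [Matrix.reindex_apply, submatrix_mul_mul, Matrix.submatrix_submatrix, Equiv.symm_symm, Equiv.symm_comp_self, Matrix.submatrix_id_id]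

include hk hKD in
/-- **`(KD h KD⁻¹)_Δ = k_w · h_Δ · k_w⁻¹`** (the `Δ`-block `h₁₁ + h₁₂`, ★ `deltaBlock`). [cite: Kudla1994, §3] [cite: HarrisKudlaSweet1996, §1 (1.15)] -/
theorem deltaBlock_localCongr_kd (p : UnitaryGroup.localPi E c (n + n) JD v) (w : PlacesOver E v) :
    deltaBlock F E c v n w (localCongr E c KD ha hKDJ v p) =
      ((Matrix.GeneralLinearGroup.map (algebraMap E (w.1.adicCompletion E)) k : GL (Fin n) (w.1.adicCompletion E)) : Matrix _ _ _) *
        deltaBlock F E c v n w p *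
        (((Matrix.GeneralLinearGroup.map (algebraMap E (w.1.adicCompletion E)) k)⁻¹ : GL (Fin n) (w.1.adicCompletion E)) : Matrix _ _ _) := by
  unfold deltaBlock
  simp only []
  rw [reindex_coe_localCongr_kd F E c v n k₀ hk hKD ha hKDJ p w, fromBlocks_diag_conj_eq, Matrix.toBlocks_fromBlocks₁₁, Matrix.toBlocks_fromBlocks₁₂,
    ← Matrix.add_mul, ← Matrix.mul_add]

include hk hKD in
/-- **`det_Δ (KD h KD⁻¹) = det_Δ h`** at every place `w ∣ v`. [cite: Kudla1994, §3] [cite: HarrisKudlaSweet1996, §1 (1.15)] -/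
theorem detDelta_localCongr_kd (p : UnitaryGroup.localPi E c (n + n) JD v) (w : PlacesOver E v) :
    detDelta F E c v n w (localCongr E c KD ha hKDJ v p) = detDelta F E c v n w p := by
  unfold detDelta
  rw [deltaBlock_localCongr_kd F E c v n k₀ hk hKD ha hKDJ p w]
  exact Matrix.det_units_conj _ _

include hk hKD in
/-- **`P_Δ` is `Ad(KD)`-stable**: `KD h KD⁻¹ ∈ P_Δ ↔ h ∈ P_Δ` (the block condition `h₁₁ + h₁₂ = h₂₁ + h₂₂`, ★ `isSiegelDelta_iff_blocks`, is conjugated by `k_w`).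
[cite: Kudla1994, §2, §3] [cite: HarrisKudlaSweet1996, §1 (1.11)] -/
theorem isSiegelDelta_localCongr_kd_iff [Algebra.IsQuadraticExtension F E] {δ : E} (hcδ : c δ = -δ) (hδ : δ ≠ 0) {d : F}
    (hd : δ * δ = algebraMap F E d) (hT₀ : T₀.IsSymm) (p : UnitaryGroup.localPi E c (n + n) JD v) :
    IsSiegelDelta F E c hcδ hδ hd v n hT₀ hJD (localCongr E c KD ha hKDJ v p) ↔ IsSiegelDelta F E c hcδ hδ hd v n hT₀ hJD p := by
  rw [isSiegelDelta_iff_blocks, isSiegelDelta_iff_blocks]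
  refine forall_congr' fun w => ?_
  rw [reindex_coe_localCongr_kd F E c v n k₀ hk hKD ha hKDJ p w, fromBlocks_diag_conj_eq, Matrix.toBlocks_fromBlocks₁₁, Matrix.toBlocks_fromBlocks₁₂,
    Matrix.toBlocks_fromBlocks₂₁, Matrix.toBlocks_fromBlocks₂₂, ← Matrix.add_mul, ← Matrix.mul_add, ← Matrix.add_mul, ← Matrix.mul_add]
  constructor
  · intro h
    have h' := congrArg (fun M => (((Matrix.GeneralLinearGroup.map (algebraMap E (w.1.adicCompletion E)) k)⁻¹ : GL (Fin n) (w.1.adicCompletion E)) :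
        Matrix _ _ _) * M * ((Matrix.GeneralLinearGroup.map (algebraMap E (w.1.adicCompletion E)) k : GL (Fin n) (w.1.adicCompletion E)) : Matrix _ _ _)) h
    simpa only [Matrix.mul_assoc, Units.inv_mul, Matrix.mul_one, Units.inv_mul_cancel_left] using h'
  · intro h
    rw [h]

include hk hKD in
/-- **`χ_v(det_Δ (KD h KD⁻¹)) = χ_v(det_Δ h)`** for every family of characters `χ_w`. [cite: HarrisKudlaSweet1996, §1 (1.15)] -/
theorem chiDet_localCongr_kd (χv : ∀ w : PlacesOver E v, (w.1.adicCompletion E)ˣ →* ℂˣ) (p : UnitaryGroup.localPi E c (n + n) JD v) :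
    chiDet F E c v n χv (localCongr E c KD ha hKDJ v p) = chiDet F E c v n χv p := by
  classical
  unfold chiDet
  refine Finset.prod_congr rfl fun w _ => ?_
  have e := detDelta_localCongr_kd F E c v n k₀ hk hKD ha hKDJ p w
  by_cases hu : IsUnit (detDelta F E c v n w p)
  · have hu' : IsUnit (detDelta F E c v n w (localCongr E c KD ha hKDJ v p)) := by rw [e]; exact hu
    have hunit : hu'.unit = hu.unit := Units.ext (by rw [IsUnit.unit_spec, IsUnit.unit_spec, e])
    rw [dif_pos hu', dif_pos hu, hunit]
  · have hu' : ¬ IsUnit (detDelta F E c v n w (localCongr E c KD ha hKDJ v p)) := by rw [e]; exact hu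
    rw [dif_neg hu', dif_neg hu]

include hk hKD in
/-- the modulus `‖det_Δ‖` is `Ad(KD)`-invariant. [cite: HarrisKudlaSweet1996, §1 (1.16)] -/
theorem norm_detDelta_localCongr_kd (p : UnitaryGroup.localPi E c (n + n) JD v) (w : PlacesOver E v) :
    ‖detDelta F E c v n w (localCongr E c KD ha hKDJ v p)‖ = ‖detDelta F E c v n w p‖ := by
  rw [detDelta_localCongr_kd F E c v n k₀ hk hKD ha hKDJ p w]

end Blocks

/-! ## §3 `Ad(KD)(g ⊕ 1) = Ad(k)(g) ⊕ 1` -/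

section Inl

variable {a : E} (ha : a ≠ 0) (hKDJ : formCongr (c : E →+* E) KD (a • JD) = JD) (hkJ : formCongr (c : E →+* E) k (a • J) = J)

include hk hKD in
/-- **`KD (g ⊕ 1) KD⁻¹ = (k g k⁻¹) ⊕ 1`**: `Ad(KD)` on the doubled group is compatible with `g ↦ g ⊕ 1` (★ `inlLoc`) and `Ad(k)` on `U(T₀)(F_v)`.
[cite: GelbartRogawski1991, §3.1 Prop. 3.1.1 p. 455 L1–3] [cite: PlatonovRapinchuk1994, §2.3] -/
theorem localCongr_kd_inlLoc (g : UnitaryGroup.localPi E c n J v) :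
    localCongr E c KD ha hKDJ v (inlLoc F E c v n hJ hJD g) = inlLoc F E c v n hJ hJD (localCongr E c k ha hkJ v g) := by
  refine Subtype.ext (funext fun w => Units.ext ?_)
  apply (Matrix.reindex (e₂ n).symm (e₂ n).symm).injective
  rw [reindex_coe_localCongr_kd F E c v n k₀ hk hKD ha hKDJ _ w, inlLoc_apply, inlLoc_apply, UnitaryGroup.coe_reindexGL, UnitaryGroup.coe_reindexGL,
    UnitaryGroup.coe_blockDiagGL, UnitaryGroup.coe_blockDiagGL, Matrix.reindex_apply, Matrix.reindex_apply, Matrix.reindex_apply, Matrix.reindex_apply,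
    Matrix.submatrix_submatrix, Matrix.submatrix_submatrix]
  simp only [Equiv.symm_symm, Equiv.symm_comp_self, Matrix.submatrix_id_id, Units.val_one]
  rw [fromBlocks_diag_mul_mul_fromBlocks_diag, Matrix.mul_one, Units.mul_inv, Matrix.mul_zero, Matrix.zero_mul, coe_localCongr_apply_apply,
    Units.val_mul, Units.val_mul]

end Inl

end Literature.NumberTheory.GelbartRogawski1991.UnitaryDualPair.LocalSplitting

end
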